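import Mathlib.Tactic.Linarith
import Summits.CriticalPhenomena.PercolationContinuityZ3.Theorems.PercNearOneGluingNoHeavyLowerTailSahiCTCNcSplitNested
import HarnessLib

/-!
# `NoHeavyLowerTail` (crux stmt-CriticalPhenomena-4575), P3 lane: the level split for NESTED complexes — `R_c(K_X,K_Z) ∈ ℕ[r]` when
# `K_X ⊆ K_Z`, hence **`Ñ_c(K_X,K_Z) ∈ ℕ[r]` for every nested pair of complexes and EVERY level `c`** (CTC on nested pairs, all levels)

Support file (seat `prim-l12-p3`, gen 23; `--supports stmt-CriticalPhenomena-4575`).  Memo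
`run/shared/lean/prim/prim-l12/FROM-prim-l12-p3-g23-LEVEL-SPLIT.md` §1.3.  Companions: `…SahiCTCNcSplit` (`Ñ_c = Π·T_c + e_c·R_c`,
`coeff_Ngen_nonneg_of_split`), `…SahiCTCNcSplitNested` (`T_c ∈ ℕ[r]` for nested skeleta).

For down-sets `K_X ⊆ K_Z` write `h_X, t_X` (faces of `K_X` of size `≤ c` / `> c`), `h_Z, t_Z`, and `N_s, N_b` = GF(non-faces of `K_Z` of
size `≤ c` / `> c`).  Then `h_Y = h_X`, `Π = h_Z + t_Z + N_b + N_s`, `D_c = t_Z + N_b`, `K_X = h_X + t_X`, and expanding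
`R_c = D_c·(Π·h_Y − K_X·K_Z) + Π·t_X·t_Z` gives
  **`R_c(K_X,K_Z) = N_s·K_X·t_Z + N_b·(Π·h_X − K_X·h_Z)`**                 (`RcForm_eq_of_nested`),
where the bracket is the HARRIS BLOCK of the down-sets `K_X` and `h_Z` (`K_X ∩ h_Z = h_X` by nestedness), nonnegative coefficientwise by
`…SahiCTCHarrisBlock.coeff_harris_sub_nonneg`.  Hence `R_c ∈ ℕ[r]` (`coeff_RcForm_nonneg_of_nested`; by the symmetry `RcForm_comm` also
for `K_Z ⊆ K_X`), and with `coeff_TcForm_nonneg_of_nested`: **`Ñ_c(K_X,K_Z) ∈ ℕ[r]` for all nested pairs of down-sets, every `c`, every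
finite ground set** (`coeff_Ngen_nonneg_of_nested`, `…_of_nested'`, `coeff_Ngen_self_nonneg`) — the diagonal/nested case of the lane's
conjecture CTC at every level (memo g10 §2 had the all-live diagonal at `c = 2`).  Nothing is asserted about the crux.
-/

namespace Summit.CriticalPhenomena.PercolationContinuityZ3.Theorems.SahiCTCForms

open Finset MvPolynomial SahiCTCGenFun

variable {α : Type*} [DecidableEq α] [Fintype α]

/-- `D_c = t_K + N_b`: the big sets are the big faces of `K` plus the big non-members of `K`. [this work] -/
theorem DdC_eq_facesGT_add (c : ℕ) (K : Finset (Finset α)) :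
    (DdC c : MvPolynomial α ℤ) = gf (facesGT c K) + gf (univ.powerset.filter fun S : Finset α => c < #S ∧ S ∉ K) := by
  unfold DdC bySize
  rw [← gf_union]
  · congr 1
    ext S
    simp only [facesGT, mem_union, mem_filter, mem_powerset, subset_univ, true_and]
    by_cases hS : S ∈ K
    · constructor
      · intro h; exact Or.inl ⟨h, hS⟩
      · rintro (⟨h, -⟩ | ⟨h, -⟩) <;> exact h
    · constructor
      · intro h; exact Or.inr ⟨h, hS⟩
      · rintro (⟨h, -⟩ | ⟨h, -⟩) <;> exact h
  · rw [disjoint_left]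
    intro S h1 h2
    exact (mem_filter.1 h2).2.2 (mem_filter.1 h1).2.2

/-- `Π = h_K + t_K + N_b + N_s`. [this work] -/
theorem PiP_eq_four_parts (c : ℕ) (K : Finset (Finset α)) :
    (PiP : MvPolynomial α ℤ) = gf (facesLE c K) + gf (facesGT c K) + gf (univ.powerset.filter fun S : Finset α => c < #S ∧ S ∉ K) +
      gf (univ.powerset.filter fun S : Finset α => #S ≤ c ∧ S ∉ K) := by
  rw [PiP_eq_facesLE_add c K, DdC_eq_facesGT_add c K]; ring

/-- Nested complexes have nested skeleta. [this work] -/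
theorem facesLE_mono (c : ℕ) {KX KZ : Finset (Finset α)} (hsub : KX ⊆ KZ) : facesLE c KX ⊆ facesLE c KZ := by
  intro S hS
  simp only [facesLE, mem_filter, mem_powerset, subset_univ, true_and] at hS ⊢
  exact ⟨hS.1, hsub hS.2⟩

/-- For `K_X ⊆ K_Z`: `K_X ∩ h_Z = h_X`. [this work] -/
theorem inter_facesLE_of_subset (c : ℕ) {KX KZ : Finset (Finset α)} (hsub : KX ⊆ KZ) : KX ∩ facesLE c KZ = facesLE c KX := by
  ext S
  simp only [facesLE, mem_inter, mem_filter, mem_powerset, subset_univ, true_and]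
  constructor
  · rintro ⟨h1, h2, -⟩; exact ⟨h2, h1⟩
  · rintro ⟨h1, h2⟩; exact ⟨h2, h1, hsub h2⟩

/-- **`R_c` for nested complexes, closed form**: for `K_X ⊆ K_Z`,
`R_c(K_X,K_Z) = N_s·K_X·t_Z + N_b·(Π·h_X − K_X·h_Z)` (the bracket is the Harris block of `K_X` and `h_Z`). [this work] -/
theorem RcForm_eq_of_nested (c : ℕ) {KX KZ : Finset (Finset α)} (hsub : KX ⊆ KZ) :
    RcForm c KX KZ =
      gf (univ.powerset.filter fun S : Finset α => #S ≤ c ∧ S ∉ KZ) * gf KX * gf (facesGT c KZ) +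
      gf (univ.powerset.filter fun S : Finset α => c < #S ∧ S ∉ KZ) * (PiP * gf (KX ∩ facesLE c KZ) - gf KX * gf (facesLE c KZ)) := by
  rw [inter_facesLE_of_subset c hsub]
  unfold RcForm
  rw [commonLE_eq_of_nested c (facesLE_mono c hsub), gf_eq_facesLE_add_facesGT c KX, gf_eq_facesLE_add_facesGT c KZ,
    PiP_eq_four_parts c KZ, DdC_eq_facesGT_add c KZ]
  ring

/-- **`R_c(K_X,K_Z) ∈ ℕ[r]` for nested down-sets `K_X ⊆ K_Z`** (every `c`, every finite ground set). [this work] -/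
theorem coeff_RcForm_nonneg_of_nested (c : ℕ) {KX KZ : Finset (Finset α)} (hKX : IsLowerSet (KX : Set (Finset α)))
    (hKZ : IsLowerSet (KZ : Set (Finset α))) (hsub : KX ⊆ KZ) : ∀ n, 0 ≤ (RcForm c KX KZ).coeff n := by
  have g := fun F : Finset (Finset α) => coeff_gf_nonneg F
  have hH : ∀ m, 0 ≤ (PiP * gf (KX ∩ facesLE c KZ) - gf KX * gf (facesLE c KZ) : MvPolynomial α ℤ).coeff m :=
    coeff_harris_sub_nonneg hKX (isLowerSet_facesLE c hKZ)
  intro n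
  rw [RcForm_eq_of_nested c hsub]
  exact cw_add (cw_mul (cw_mul (g _) (g _)) (g _)) (cw_mul (g _) hH) n

/-- `R_c` is symmetric under `X ↔ Z`. [this work] -/
theorem RcForm_comm (c : ℕ) (KX KZ : Finset (Finset α)) : RcForm c KX KZ = RcForm c KZ KX := by
  unfold RcForm; rw [commonLE_comm c KZ KX]; ring

/-- The symmetric case `K_Z ⊆ K_X`. [this work] -/
theorem coeff_RcForm_nonneg_of_nested' (c : ℕ) {KX KZ : Finset (Finset α)} (hKX : IsLowerSet (KX : Set (Finset α)))
    (hKZ : IsLowerSet (KZ : Set (Finset α))) (hsub : KZ ⊆ KX) : ∀ n, 0 ≤ (RcForm c KX KZ).coeff n := by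
  intro n; rw [RcForm_comm]; exact coeff_RcForm_nonneg_of_nested c hKZ hKX hsub n

/-- **CTC ON NESTED PAIRS, EVERY LEVEL: `Ñ_c(K_X,K_Z) ∈ ℕ[r]` for down-sets `K_X ⊆ K_Z`**, every `c`, every finite ground set — by the level
split (`coeff_Ngen_nonneg_of_split`) with `T_c ≥ 0` (nested skeleta) and `R_c ≥ 0` (this file). [this work] -/
theorem coeff_Ngen_nonneg_of_nested (c : ℕ) {KX KZ : Finset (Finset α)} (hKX : IsLowerSet (KX : Set (Finset α)))
    (hKZ : IsLowerSet (KZ : Set (Finset α))) (hsub : KX ⊆ KZ) : ∀ n, 0 ≤ (Ngen c KX KZ).coeff n :=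
  coeff_Ngen_nonneg_of_split (coeff_TcForm_nonneg_of_nested c hKX (facesLE_mono c hsub)) (coeff_RcForm_nonneg_of_nested c hKX hKZ hsub)

/-- The symmetric case `K_Z ⊆ K_X`. [this work] -/
theorem coeff_Ngen_nonneg_of_nested' (c : ℕ) {KX KZ : Finset (Finset α)} (hKX : IsLowerSet (KX : Set (Finset α)))
    (hKZ : IsLowerSet (KZ : Set (Finset α))) (hsub : KZ ⊆ KX) : ∀ n, 0 ≤ (Ngen c KX KZ).coeff n := by
  intro n; rw [Ngen_comm]; exact coeff_Ngen_nonneg_of_nested c hKZ hKX hsub n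

/-- **The diagonal: `Ñ_c(K,K) ∈ ℕ[r]`** for every down-set `K` and every `c`. [this work] -/
theorem coeff_Ngen_self_nonneg (c : ℕ) {K : Finset (Finset α)} (hK : IsLowerSet (K : Set (Finset α))) :
    ∀ n, 0 ≤ (Ngen c K K).coeff n :=
  coeff_Ngen_nonneg_of_nested c hK hK Subset.rfl

/-- Value-level reading: for nested complexes `Ñ_c(r) ≥ 0` at every `r ≥ 0` (the (TC) row of the level-`c` threshold certificate holds at a
nested pair of sections). [this work] -/
theorem eval_Ngen_nonneg_of_nested (c : ℕ) {KX KZ : Finset (Finset α)} (hKX : IsLowerSet (KX : Set (Finset α)))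
    (hKZ : IsLowerSet (KZ : Set (Finset α))) (hsub : KX ⊆ KZ) (r : α → ℝ) (hr : ∀ i, 0 ≤ r i) :
    0 ≤ eval₂ (Int.castRingHom ℝ) r (Ngen c KX KZ) := by
  have h := eval_le_of_coeff_le (P := (0 : MvPolynomial α ℤ)) (Q := Ngen c KX KZ)
    (fun m => by rw [coeff_zero]; exact coeff_Ngen_nonneg_of_nested c hKX hKZ hsub m) r hr
  rwa [eval₂_zero] at h

end Summit.CriticalPhenomena.PercolationContinuityZ3.Theorems.SahiCTCForms
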